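import Literature.NumberTheory.GaloisCohomology.Howard2004.DivisibleTorsionModuleProofs
import Mathlib.LinearAlgebra.Projection
import HarnessLib

/-!
# Howard 2004, Theorem 1.6.1, conclusion (ii) «`H¹_F(K, A) ≅ 𝒟 ⊕ M ⊕ M`» — the colimit algebra, II:
# levels `X[π^{e_k}] ≅ R/𝔪^{e_k} ⊕ M_k ⊕ M_k` force `X ≅ 𝒟 ⊕ M_k ⊕ M_k`
# (theorems only; no definition, no named fact, no instance, no `sorry`)

Source: B. Howard, *The Heegner point Kolyvagin system*, Compositio Math. **140** (2004), Thm. 1.6.1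
(= arXiv:1202.6340 Thm. 2.6.1, p. 11 L23–28), proof p. 12 L40–48: «… `H¹_F(K, A) ≅ lim→ H¹_F(K, T^{(k)})`,
the level `k` term being `≅ R/𝔪^{e_k} ⊕ M^{(k)} ⊕ M^{(k)}` [Thm. 1.4.2, Prop. 1.5.5 with `ε = 1`] and equal to the
`𝔪^{e_k}`-torsion of the limit [Lemma 1.3.3]; hence `H¹_F(K, A) ≅ 𝒟 ⊕ M ⊕ M` with `M = M^{(k)}` for `k ≫ 0`.»

Sequel to `DivisibleTorsionModuleProofs` (part I: `π`-power-torsion modules with cyclic torsion levels are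
`≅ 𝒟 = FracModR R`).  THIS FILE, part II, in the currency of `Howard2004.DVRSetting.Conclusion` (ii):

* one level: `level_eq_smul_add` (`z = a · u_k + ι_k(m)` for `θ_k(z) = (ā, m)`), `smul_symm_one_eq_zero_iff`
  (`ann(u_k) = 𝔪^{e_k}`), `pow_sub_dvd_of_level_torsion` (`π^n z = 0 ⇒ π^(e_k-n) ∣ a`);
* `exists_linearEquiv_fracModR_range_pow_smul` — the divisible part `π^c X ≃ₗ[R] 𝒟` (part I applies: the
  `𝔪^n`-torsion of `π^c X` is generated by `π^(e_k-n) u_k`, `e_k ≥ n + c`);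
* `isCompl_range_pow_smul_range_level` — `X = π^c X ⊕ ι_k(M_k × M_k)` internally for every `k` with `2c ≤ e_k`;
* **`exists_linearEquiv_fracModR_prod_of_torsionLevels`** — for an `𝔪`-power-torsion `R`-module `X` with
  `R`-linear level structures `θ_k : X[π^{e_k}] ≅ R/𝔪^{e_k} × (M_k × M_k)`, `π^c M_k = 0`, `e` unbounded:
  `X ≃ₗ[R] FracModR R × (M_k × M_k)` for EVERY `k` with `2c ≤ e_k` — the structure module is LITERALLY a level
  module `M_k`, so the levelwise length bound of `DVRSetting.exists_isFreeRankOneOn_length_le_of_printedInputs`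
  (DVRKolyvaginBoundProofs §I) transfers to conclusion (iii) without any module isomorphism;
  `exists_addEquiv_fracModR_prod_of_torsionLevels` is the same in the additive-plus-equivariance phrasing of
  `DVRSetting.Conclusion`.

HOW A REDUCTION OF `thm161_dvrKolyvaginBound` USES THIS (not done here): `X := H¹_F(K, A) = selmerA` with its
levelwise `R`-action, `X_k := X[π^{e_k}]` identified with `H¹_F(K, T^{(k)})` by Lemma 1.3.3 (control, both
directions), `θ_k` from Thm. 1.4.2 / Prop. 1.5.5 (`ε = 1`, `π^c M_k = 0` uniformly by Lemma 1.6.4 with `κ_1 ≠ 0`);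
then take `k ≥ k₀` of §I with `2c ≤ e_k`.

HONEST FRAMING: this is NOT `thm161_dvrKolyvaginBound`: the levelwise structure (Thm. 1.4.2 / Prop. 1.5.5), the
identification of the levels with the torsion of `H¹_F(K, A)` (Lemma 1.3.3), Lemma 1.6.4 and the `DVRSetting` glue
remain.  No summit statement is proved; the Birch–Swinnerton-Dyer conjecture is not proved by any of this.
-/

set_option autoImplicit false

noncomputable section

namespace Literature.NumberTheory.GaloisCohomology.Howard2004

/-! ## §B. Levels `X[π^{e_k}] ≅ R/𝔪^{e_k} ⊕ M_k ⊕ M_k` with `π^c M_k = 0` force `X ≅ 𝒟 ⊕ M_k ⊕ M_k` (p. 12 L40–48) -/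

section OneLevel

variable {R : Type} [CommRing R] [IsDomain R] [IsDiscreteValuationRing R] {π : R}
  {X : Type*} [AddCommGroup X] [Module R X] {Xk : Submodule R X}
  {Mk : Type*} [AddCommGroup Mk] [Module R Mk] {ek : ℕ}

/-- **Reading one level.**  If `θ : X_k ≅ R/𝔪^{e_k} × (M_k × M_k)` and `θ(z) = (ā, m)`, then
`z = a · u_k + ι_k(m)` with `u_k = θ⁻¹(1, 0)` the free-part generator and `ι_k(m) = θ⁻¹(0, m)` — for ANY
lift `a` of `ā`. [cite: Howard2004HeegnerKolyvagin, Thm. 1.6.1, proof (arXiv p. 12, L40–48)] -/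
theorem level_eq_smul_add (θk : ↥Xk ≃ₗ[R] (R ⧸ IsLocalRing.maximalIdeal R ^ ek) × (Mk × Mk)) {z : X}
    (hz : z ∈ Xk) {a : R} {m : Mk × Mk}
    (h : θk ⟨z, hz⟩ = (Ideal.Quotient.mk (IsLocalRing.maximalIdeal R ^ ek) a, m)) :
    z = a • (θk.symm (1, 0) : X) + (θk.symm (0, m) : X) := by
  have h' : (⟨z, hz⟩ : ↥Xk) = a • θk.symm (1, 0) + θk.symm (0, m) := by
    apply θk.injective
    rw [map_add, map_smul, LinearEquiv.apply_symm_apply, LinearEquiv.apply_symm_apply, h,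
      Prod.smul_mk, smul_zero, Prod.mk_add_mk, add_zero, zero_add, smul_one_eq_mk]
  have h'' := congrArg Subtype.val h'
  rwa [Submodule.coe_add, Submodule.coe_smul] at h''

/-- The free-part generator `u_k = θ⁻¹(1, 0)` of the level `X_k ≅ R/𝔪^{e_k} × (M_k × M_k)` has annihilator
exactly `𝔪^{e_k}`. [cite: Howard2004HeegnerKolyvagin, Thm. 1.6.1, proof (arXiv p. 12, L40–48)] -/
theorem smul_symm_one_eq_zero_iff (θk : ↥Xk ≃ₗ[R] (R ⧸ IsLocalRing.maximalIdeal R ^ ek) × (Mk × Mk))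
    (r : R) : r • (θk.symm (1, 0) : X) = 0 ↔ r ∈ IsLocalRing.maximalIdeal R ^ ek := by
  rw [← Submodule.coe_smul, Submodule.coe_eq_zero, ← map_smul, LinearEquiv.map_eq_zero_iff,
    Prod.smul_mk, smul_zero, Prod.mk_eq_zero, smul_one_quot_eq_zero_iff]
  exact and_iff_left rfl

/-- **Torsion read on a level.**  If `θ(z) = (ā, m)` on `X_k ≅ R/𝔪^{e_k} × (M_k × M_k)` and `π^n z = 0` with
`n ≤ e_k`, then `π^(e_k - n) ∣ a` for any lift `a`: the free coordinate of an `𝔪^n`-torsion class lies in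
`𝔪^(e_k - n)/𝔪^{e_k}`. [cite: Howard2004HeegnerKolyvagin, Thm. 1.6.1, proof (arXiv p. 12, L40–48)] -/
theorem pow_sub_dvd_of_level_torsion (hunif : IsLocalRing.maximalIdeal R = Ideal.span {π})
    (θk : ↥Xk ≃ₗ[R] (R ⧸ IsLocalRing.maximalIdeal R ^ ek) × (Mk × Mk)) {z : X} (hz : z ∈ Xk)
    {a : R} {m : Mk × Mk} (h : θk ⟨z, hz⟩ = (Ideal.Quotient.mk (IsLocalRing.maximalIdeal R ^ ek) a, m))
    {n : ℕ} (hn : n ≤ ek) (hzn : π ^ n • z = 0) : π ^ (ek - n) ∣ a := by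
  have h0 : π ^ n • (⟨z, hz⟩ : ↥Xk) = 0 := Subtype.ext (by rw [Submodule.coe_smul, Submodule.coe_zero, hzn])
  have h1 : π ^ n • θk ⟨z, hz⟩ = 0 := by rw [← map_smul, h0, map_zero]
  rw [h, Prod.smul_mk, Prod.mk_eq_zero] at h1
  exact pow_sub_dvd_of_pow_smul_mk_eq_zero hunif hn h1.1

/-- The torsion part `ι_k(M_k × M_k) = θ⁻¹(0 × (M_k × M_k))` of a level is killed by `π^c` when `π^c M_k = 0`.
[cite: Howard2004HeegnerKolyvagin, Thm. 1.6.1, proof (arXiv p. 12, L40–48)] -/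
theorem pow_smul_symm_zero_eq_zero (θk : ↥Xk ≃ₗ[R] (R ⧸ IsLocalRing.maximalIdeal R ^ ek) × (Mk × Mk))
    {c : ℕ} (hMk : ∀ m : Mk, π ^ c • m = 0) (m : Mk × Mk) : π ^ c • (θk.symm (0, m) : X) = 0 := by
  have hm : π ^ c • m = 0 := Prod.ext (hMk m.1) (hMk m.2)
  rw [← Submodule.coe_smul, ← map_smul, Prod.smul_mk, smul_zero, hm]
  show ((θk.symm 0 : ↥Xk) : X) = 0
  rw [map_zero, Submodule.coe_zero]

end OneLevel

section LevelStructure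

variable {R : Type} [CommRing R] [IsDomain R] [IsDiscreteValuationRing R] {π : R}
  {X : Type*} [AddCommGroup X] [Module R X]
  {M : ℕ → Type*} [∀ k, AddCommGroup (M k)] [∀ k, Module R (M k)]

/-- **The divisible part `π^c X ≅ 𝒟`.**  For an `𝔪`-power-torsion `X` with levels
`X[π^{e_k}] ≅ R/𝔪^{e_k} × (M_k × M_k)`, `π^c M_k = 0`, `e` unbounded: the submodule `π^c X` satisfies the
hypotheses of `exists_linearEquiv_fracModR_of_cyclicTorsionLevels` — its `𝔪^n`-torsion is generated by
`π^(e_k - n) u_k` (`e_k ≥ n + c`), of annihilator exactly `𝔪^n` — hence `π^c X ≃ₗ[R] 𝒟`.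
[cite: Howard2004HeegnerKolyvagin, Thm. 1.6.1, proof (arXiv p. 12, L44–48)] -/
theorem exists_linearEquiv_fracModR_range_pow_smul (hunif : IsLocalRing.maximalIdeal R = Ideal.span {π})
    (htors : ∀ x : X, ∃ n : ℕ, π ^ n • x = 0) (e : ℕ → ℕ) (he : ∀ n : ℕ, ∃ k, n ≤ e k)
    (Xl : ℕ → Submodule R X) (hXl : ∀ (k : ℕ) (x : X), x ∈ Xl k ↔ π ^ e k • x = 0) (c : ℕ)
    (hM : ∀ (k : ℕ) (m : M k), π ^ c • m = 0)
    (θ : ∀ k, ↥(Xl k) ≃ₗ[R] (R ⧸ IsLocalRing.maximalIdeal R ^ e k) × (M k × M k)) :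
    Nonempty (↥(LinearMap.range (π ^ c • (LinearMap.id : X →ₗ[R] X))) ≃ₗ[R] FracModR R) := by
  set D := LinearMap.range (π ^ c • (LinearMap.id : X →ₗ[R] X)) with hD
  have hmemD : ∀ x : X, x ∈ D ↔ ∃ z : X, π ^ c • z = x := fun x => by
    rw [hD, LinearMap.mem_range]; rfl
  refine exists_linearEquiv_fracModR_of_cyclicTorsionLevels hunif (fun x => ?_) (fun n => ?_)
  · obtain ⟨n, hn⟩ := htors (x : X)
    exact ⟨n, Subtype.ext (by rw [Submodule.coe_smul, Submodule.coe_zero, hn])⟩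
  · obtain ⟨k, hk⟩ := he (n + c)
    -- the generator `y = π^(e_k - n) u_k ∈ π^c X`
    have hy : π ^ (e k - n) • ((θ k).symm (1, 0) : X) ∈ D := by
      rw [hmemD]
      refine ⟨π ^ (e k - n - c) • ((θ k).symm (1, 0) : X), ?_⟩
      rw [smul_smul, ← pow_add, show c + (e k - n - c) = e k - n by omega]
    refine ⟨⟨_, hy⟩, fun r => ?_, fun x hx => ?_⟩
    · -- annihilator `𝔪^n`
      rw [Subtype.ext_iff, Submodule.coe_smul, Submodule.coe_zero, smul_smul, smul_symm_one_eq_zero_iff,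
        mem_maximalIdeal_pow_iff_pow_dvd hunif, mem_maximalIdeal_pow_iff_pow_dvd hunif, mul_comm]
      constructor
      · intro h
        exact pow_dvd_of_pow_add_dvd_pow_mul hunif (n := e k - n)
          (by rwa [show e k - n + n = e k by omega])
      · rintro ⟨s, rfl⟩
        exact ⟨s, by rw [← mul_assoc, ← pow_add, show e k - n + n = e k by omega]⟩
    · -- generation of the `𝔪^n`-torsion of `π^c X`
      obtain ⟨z, hz⟩ := (hmemD x).mp x.2
      have hx' : π ^ n • (x : X) = 0 := by
        rw [← Submodule.coe_smul, hx, Submodule.coe_zero]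
      have hzn : π ^ (n + c) • z = 0 := by rw [pow_add, mul_smul, hz, hx']
      have hzk : z ∈ Xl k := by
        rw [hXl, ← Nat.sub_add_cancel hk, pow_add, mul_smul, hzn, smul_zero]
      obtain ⟨a, ha⟩ := Ideal.Quotient.mk_surjective ((θ k) ⟨z, hzk⟩).1
      have hθz : (θ k) ⟨z, hzk⟩ = (Ideal.Quotient.mk _ a, ((θ k) ⟨z, hzk⟩).2) := by rw [ha]
      obtain ⟨b, hb⟩ := pow_sub_dvd_of_level_torsion hunif (θ k) hzk hθz hk hzn
      refine ⟨b, Subtype.ext ?_⟩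
      rw [Submodule.coe_smul, ← hz, level_eq_smul_add (θ k) hzk hθz, smul_add,
        pow_smul_symm_zero_eq_zero (θ k) (hM k), add_zero, smul_smul, smul_smul, hb]
      congr 1
      rw [← mul_assoc, ← pow_add, show c + (e k - (n + c)) = e k - n by omega, mul_comm]

/-- **`π^c X` and `ι_k(M_k × M_k)` are complementary** for every level `k` with `2c ≤ e_k`: they meet
trivially (an element of both is `π^c z` with `π^(2c) z = 0`, read on level `k`), and together span (any `x`,
read on a level `k'` with `e_{k'} ≥ n + c` where `π^n x = 0`, is `π^c(…) +` an element killed by `π^c`,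
and the latter, read on level `k`, is `π^c(…) + ι_k(…)` since `e_k - c ≥ c`).
[cite: Howard2004HeegnerKolyvagin, Thm. 1.6.1, proof (arXiv p. 12, L40–48)] -/
theorem isCompl_range_pow_smul_range_level (hunif : IsLocalRing.maximalIdeal R = Ideal.span {π})
    (htors : ∀ x : X, ∃ n : ℕ, π ^ n • x = 0) (e : ℕ → ℕ) (he : ∀ n : ℕ, ∃ k, n ≤ e k)
    (Xl : ℕ → Submodule R X) (hXl : ∀ (k : ℕ) (x : X), x ∈ Xl k ↔ π ^ e k • x = 0) (c : ℕ)
    (hM : ∀ (k : ℕ) (m : M k), π ^ c • m = 0)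
    (θ : ∀ k, ↥(Xl k) ≃ₗ[R] (R ⧸ IsLocalRing.maximalIdeal R ^ e k) × (M k × M k))
    (k : ℕ) (hk : 2 * c ≤ e k) :
    IsCompl (LinearMap.range (π ^ c • (LinearMap.id : X →ₗ[R] X)))
      (LinearMap.range ((Xl k).subtype ∘ₗ (θ k).symm.toLinearMap ∘ₗ
        LinearMap.inr R (R ⧸ IsLocalRing.maximalIdeal R ^ e k) (M k × M k))) := by
  set D := LinearMap.range (π ^ c • (LinearMap.id : X →ₗ[R] X)) with hD
  set C := LinearMap.range ((Xl k).subtype ∘ₗ (θ k).symm.toLinearMap ∘ₗ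
        LinearMap.inr R (R ⧸ IsLocalRing.maximalIdeal R ^ e k) (M k × M k)) with hC
  have hmemD : ∀ x : X, x ∈ D ↔ ∃ z : X, π ^ c • z = x := fun x => by
    rw [hD, LinearMap.mem_range]; rfl
  have hmemC : ∀ x : X, x ∈ C ↔ ∃ m : M k × M k, ((θ k).symm (0, m) : X) = x := fun x => by
    rw [hC, LinearMap.mem_range]; rfl
  -- reading the `π^c`-torsion on level `k`: `x = π^c (b u_k) + ι_k(m)`
  have hsplit : ∀ x : X, π ^ c • x = 0 →
      ∃ (b : R) (m : M k × M k), x = π ^ c • (b • ((θ k).symm (1, 0) : X)) + ((θ k).symm (0, m) : X) := by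
    intro x hx
    have hck : c ≤ e k := by omega
    have hxk : x ∈ Xl k := by
      rw [hXl, ← Nat.sub_add_cancel hck, pow_add, mul_smul, hx, smul_zero]
    obtain ⟨a, ha⟩ := Ideal.Quotient.mk_surjective ((θ k) ⟨x, hxk⟩).1
    have hθx : (θ k) ⟨x, hxk⟩ = (Ideal.Quotient.mk _ a, ((θ k) ⟨x, hxk⟩).2) := by rw [ha]
    obtain ⟨b', hb'⟩ := pow_sub_dvd_of_level_torsion hunif (θ k) hxk hθx hck hx
    obtain ⟨b, hb⟩ : π ^ c ∣ a := (pow_dvd_pow π (by omega : c ≤ e k - c)).trans ⟨b', hb'⟩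
    refine ⟨b, ((θ k) ⟨x, hxk⟩).2, ?_⟩
    rw [smul_smul, ← hb]
    exact level_eq_smul_add (θ k) hxk hθx
  refine isCompl_iff.mpr ⟨Submodule.disjoint_def.mpr fun x hxD hxC => ?_,
    Submodule.codisjoint_iff_exists_add_eq.mpr fun x => ?_⟩
  · -- disjointness
    obtain ⟨z, hz⟩ := (hmemD x).mp hxD
    obtain ⟨m, hm⟩ := (hmemC x).mp hxC
    have hxc : π ^ c • x = 0 := by rw [← hm]; exact pow_smul_symm_zero_eq_zero (θ k) (hM k) m
    have hz2 : π ^ (2 * c) • z = 0 := by rw [two_mul, pow_add, mul_smul, hz, hxc]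
    have hzk : z ∈ Xl k := by
      rw [hXl, ← Nat.sub_add_cancel hk, pow_add, mul_smul, hz2, smul_zero]
    have hxk : x ∈ Xl k := by rw [← hm]; exact ((θ k).symm (0, m)).2
    have h1 : (θ k) ⟨x, hxk⟩ = (0, m) := by
      rw [← LinearEquiv.eq_symm_apply]; exact Subtype.ext hm.symm
    have h2 : (⟨x, hxk⟩ : ↥(Xl k)) = π ^ c • ⟨z, hzk⟩ := Subtype.ext (by rw [Submodule.coe_smul, hz])
    have h3 : (θ k) ⟨x, hxk⟩ = (π ^ c • ((θ k) ⟨z, hzk⟩).1, 0) := by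
      have hm2 : π ^ c • ((θ k) ⟨z, hzk⟩).2 = 0 := Prod.ext (hM k _) (hM k _)
      rw [h2, map_smul, Prod.ext_iff]
      exact ⟨rfl, hm2⟩
    have hm0 : m = 0 := by
      have := congrArg Prod.snd (h1.symm.trans h3)
      exact this
    rw [← hm, hm0]
    show (((θ k).symm 0 : ↥(Xl k)) : X) = 0
    rw [map_zero, Submodule.coe_zero]
  · -- spanning
    obtain ⟨n, hn⟩ := htors x
    obtain ⟨k', hk'⟩ := he (n + c)
    have hxk' : x ∈ Xl k' := by
      rw [hXl, ← Nat.sub_add_cancel (show n ≤ e k' by omega), pow_add, mul_smul, hn, smul_zero]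
    obtain ⟨a, ha⟩ := Ideal.Quotient.mk_surjective ((θ k') ⟨x, hxk'⟩).1
    have hθx : (θ k') ⟨x, hxk'⟩ = (Ideal.Quotient.mk _ a, ((θ k') ⟨x, hxk'⟩).2) := by rw [ha]
    obtain ⟨b', hb'⟩ := pow_sub_dvd_of_level_torsion hunif (θ k') hxk' hθx (by omega) hn
    obtain ⟨b, hb⟩ : π ^ c ∣ a := (pow_dvd_pow π (by omega : c ≤ e k' - n)).trans ⟨b', hb'⟩
    have hx1 := level_eq_smul_add (θ k') hxk' hθx
    obtain ⟨b₂, m₂, hx2⟩ := hsplit _ (pow_smul_symm_zero_eq_zero (θ k') (hM k') ((θ k') ⟨x, hxk'⟩).2)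
    refine ⟨a • ((θ k').symm (1, 0) : X) + π ^ c • (b₂ • ((θ k).symm (1, 0) : X)),
      ((θ k).symm (0, m₂) : X), ?_, (hmemC _).mpr ⟨m₂, rfl⟩, ?_⟩
    · refine D.add_mem ((hmemD _).mpr ⟨b • ((θ k').symm (1, 0) : X), ?_⟩) ((hmemD _).mpr ⟨_, rfl⟩)
      rw [smul_smul, hb]
    · rw [add_assoc, ← hx2, ← hx1]

/-- **Howard 2004, Thm. 1.6.1 (ii) — the colimit algebra, abstract form.**  Let `R` be a DVR with `𝔪 = (π)`
and `X` an `R`-module in which every element is killed by a power of `π`; suppose its levels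
`X_k = X[π^{e_k}]` (`e` unbounded) come with `R`-linear `θ_k : X_k ≅ R/𝔪^{e_k} × (M_k × M_k)` where a fixed
`π^c` kills every `M_k`.  Then for EVERY `k` with `2c ≤ e_k`, `X ≃ₗ[R] 𝒟 × (M_k × M_k)` with
`𝒟 = FracModR R = Frac(R)/R`: «`H¹_F(K, A) ≅ 𝒟 ⊕ M ⊕ M`» with `M` literally the level module `M_k`
(`X = π^c X ⊕ ι_k(M_k × M_k)` internally, `π^c X ≅ 𝒟`).
[cite: Howard2004HeegnerKolyvagin, Thm. 1.6.1 (ii), proof (arXiv p. 12, L40–48)] -/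
theorem exists_linearEquiv_fracModR_prod_of_torsionLevels
    (hunif : IsLocalRing.maximalIdeal R = Ideal.span {π})
    (htors : ∀ x : X, ∃ n : ℕ, π ^ n • x = 0) (e : ℕ → ℕ) (he : ∀ n : ℕ, ∃ k, n ≤ e k)
    (Xl : ℕ → Submodule R X) (hXl : ∀ (k : ℕ) (x : X), x ∈ Xl k ↔ π ^ e k • x = 0) (c : ℕ)
    (hM : ∀ (k : ℕ) (m : M k), π ^ c • m = 0)
    (θ : ∀ k, ↥(Xl k) ≃ₗ[R] (R ⧸ IsLocalRing.maximalIdeal R ^ e k) × (M k × M k))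
    (k : ℕ) (hk : 2 * c ≤ e k) :
    Nonempty (X ≃ₗ[R] FracModR R × (M k × M k)) := by
  obtain ⟨eD⟩ := exists_linearEquiv_fracModR_range_pow_smul hunif htors e he Xl hXl c hM θ
  have hDC := isCompl_range_pow_smul_range_level hunif htors e he Xl hXl c hM θ k hk
  set emb := (Xl k).subtype ∘ₗ (θ k).symm.toLinearMap ∘ₗ
    LinearMap.inr R (R ⧸ IsLocalRing.maximalIdeal R ^ e k) (M k × M k) with hemb
  have hinj : Function.Injective emb :=
    Subtype.val_injective.comp ((θ k).symm.injective.comp LinearMap.inr_injective)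
  exact ⟨(Submodule.prodEquivOfIsCompl _ _ hDC).symm ≪≫ₗ
    (eD.prodCongr (LinearEquiv.ofInjective emb hinj).symm)⟩

/-- **Conclusion (ii) in the additive currency of `DVRSetting.Conclusion`**: an additive `R`-equivariant
bijection `Φ : X ≃+ 𝒟 × (M_k × M_k)`, for every level `k` with `2c ≤ e_k`.
[cite: Howard2004HeegnerKolyvagin, Thm. 1.6.1 (ii), proof (arXiv p. 12, L40–48)] -/
theorem exists_addEquiv_fracModR_prod_of_torsionLevels
    (hunif : IsLocalRing.maximalIdeal R = Ideal.span {π})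
    (htors : ∀ x : X, ∃ n : ℕ, π ^ n • x = 0) (e : ℕ → ℕ) (he : ∀ n : ℕ, ∃ k, n ≤ e k)
    (Xl : ℕ → Submodule R X) (hXl : ∀ (k : ℕ) (x : X), x ∈ Xl k ↔ π ^ e k • x = 0) (c : ℕ)
    (hM : ∀ (k : ℕ) (m : M k), π ^ c • m = 0)
    (θ : ∀ k, ↥(Xl k) ≃ₗ[R] (R ⧸ IsLocalRing.maximalIdeal R ^ e k) × (M k × M k))
    (k : ℕ) (hk : 2 * c ≤ e k) :
    ∃ Φ : X ≃+ FracModR R × (M k × M k), ∀ (r : R) (x : X), Φ (r • x) = r • Φ x := by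
  obtain ⟨Φ⟩ := exists_linearEquiv_fracModR_prod_of_torsionLevels hunif htors e he Xl hXl c hM θ k hk
  exact ⟨Φ.toAddEquiv, fun r x => Φ.map_smul r x⟩

end LevelStructure

end Literature.NumberTheory.GaloisCohomology.Howard2004
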